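import Summits.NavierStokesRegularity.NavierStokesRegularity.Theorems.ExtremiserTransienceNearExtremalTransienceExtremiserLiouvilleConstantSpeedStretching
import HarnessLib

/-!
# Crux `ExtremiserTransience.NearExtremalTransience` (stmt-NavierStokesRegularity-21883), line `extremiser_liouville`,
# stub K1b — CONSTANT-SPEED FIELDS: the orthogonal vorticity IS the bend, `ω_⊥ = v × (Dv·v)/M²`, `‖ω_⊥‖ = ‖Dv·v‖/M`

`--supports stmt-NavierStokesRegularity-21883` (helper).  Author: prover seat `ns-el-k1b` (g3).

Continuation of `…ConstantSpeedStretching` (route N5', «constant-speed efficiency gap»).  For `‖v‖ ≡ M ≠ 0` the vorticity splits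
as TWIST + BEND: `ω = (⟪ω,v⟫/M²)·v + ω_⊥` with

* `curl_perp_eq_cross_fderiv_self` : **`ω_⊥ = M⁻²· v × (Dv·v)`** (from `Dv·v = ω × v`: `v × (ω × v) = M²ω − ⟪v,ω⟫v`);
* `norm_curl_perp_eq` : **`‖ω_⊥‖ = ‖Dv·v‖/M`** (`Dv·v ⊥ v`), i.e. `‖ω_⊥‖ = M·‖(v̂·∇)v̂‖` is `M` times the curvature of the
  streamlines;
* `abs_curl_stretching_le_bend` : hence **`|⟪ω, Dv ω⟫| ≤ ‖Dv‖·‖Dv·v‖²/M²`** pointwise: the stretching density of a constant-speed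
  field is controlled by the streamline CURVATURE alone (the twist `⟪ω, v⟫` enters `Z` and `W` but never `S`).

WHAT THIS IS NOT: structure lemmas for HYPOTHETICAL constant-speed extremisers; K1b is NOT proved; nothing here proves NS
regularity. [folklore]
-/

noncomputable section

open Set Filter Topology MeasureTheory Metric Function
open scoped ENNReal NNReal Topology InnerProductSpace RealInnerProductSpace ContDiff
open Literature.Analysis.FluidPDE Literature.Analysis

namespace Summit.NavierStokesRegularity.NavierStokesRegularity.Theorems

-- the problem directory repeats the summit name (`NavierStokesRegularity/NavierStokesRegularity`)
set_option linter.dupNamespace false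

namespace ExtremiserLiouville

open DepletionLadder.KStar DepletionLadder.KStar.HalfSpace

variable {v : E3 → E3} {M : ℝ}

/-- Triple product expansion `a × (b × a) = ‖a‖² b − ⟪a,b⟫ a`. [folklore] -/
theorem cross_cross_self_right (a b : E3) : cross a (cross b a) = (‖a‖ ^ 2) • b - ⟪a, b⟫_ℝ • a := by
  have hn : ‖a‖ ^ 2 = ∑ i, a i * a i := by
    rw [EuclideanSpace.norm_eq, Real.sq_sqrt (Finset.sum_nonneg fun i _ => sq_nonneg _)]
    exact Finset.sum_congr rfl fun i _ => by rw [Real.norm_eq_abs, sq_abs, sq]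
  ext i
  fin_cases i <;>
    simp [cross, cross_apply, PiLp.inner_apply, hn, Fin.sum_univ_three, Matrix.cons_val_zero, Matrix.cons_val_one,
      Matrix.cons_val_two, Matrix.head_cons, Matrix.tail_cons] <;> ring

/-- **`ω_⊥ = M⁻²· v × (Dv·v)`**: the component of the vorticity orthogonal to a constant-speed field is the rotated bend.
[folklore] -/
theorem curl_perp_eq_cross_fderiv_self (hv : Differentiable ℝ v) (hM : ∀ x, ‖v x‖ = M) (hM0 : M ≠ 0) (x : E3) :
    curl v x - (⟪curl v x, v x⟫_ℝ / M ^ 2) • v x = (M ^ 2)⁻¹ • cross (v x) (fderiv ℝ v x (v x)) := by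
  rw [fderiv_apply_self_eq_cross_curl hv hM x, cross_cross_self_right, hM x, smul_sub, smul_smul, smul_smul,
    inv_mul_cancel₀ (pow_ne_zero 2 hM0), one_smul, real_inner_comm, div_eq_inv_mul]

/-- **`‖ω_⊥‖ = ‖Dv·v‖/M`** (`Dv·v ⊥ v`, `‖v × u‖ = ‖v‖‖u‖` for `u ⊥ v`). [folklore] -/
theorem norm_curl_perp_eq (hv : Differentiable ℝ v) (hM : ∀ x, ‖v x‖ = M) (hM0 : M ≠ 0) (x : E3) :
    ‖curl v x - (⟪curl v x, v x⟫_ℝ / M ^ 2) • v x‖ = ‖fderiv ℝ v x (v x)‖ / |M| := by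
  have hMx : ‖v x‖ = M := hM x
  have hperp : ⟪v x, fderiv ℝ v x (v x)⟫_ℝ = 0 := inner_fderiv_apply_eq_zero_of_norm_eq hv hM x (v x)
  -- `‖v × u‖² = ‖v‖²‖u‖² − ⟪v,u⟫²`
  have hlag : ‖cross (v x) (fderiv ℝ v x (v x))‖ ^ 2 = ‖v x‖ ^ 2 * ‖fderiv ℝ v x (v x)‖ ^ 2 - ⟪v x, fderiv ℝ v x (v x)⟫_ℝ ^ 2 := by
    have hsq : ∀ a : E3, ‖a‖ ^ 2 = ∑ i, a i * a i := fun a => by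
      rw [EuclideanSpace.norm_eq, Real.sq_sqrt (Finset.sum_nonneg fun i _ => sq_nonneg _)]
      exact Finset.sum_congr rfl fun i _ => by rw [Real.norm_eq_abs, sq_abs, sq]
    rw [hsq, hsq, hsq]
    simp only [cross, cross_apply, PiLp.inner_apply, RCLike.inner_apply, conj_trivial, Fin.sum_univ_three, PiLp.toLp_apply,
      Matrix.cons_val_zero, Matrix.cons_val_one, Matrix.cons_val_two, Matrix.head_cons, Matrix.tail_cons]
    ring
  rw [hperp, hMx] at hlag
  have hM2 : 0 < M ^ 2 := by positivity
  have hn : ‖cross (v x) (fderiv ℝ v x (v x))‖ = |M| * ‖fderiv ℝ v x (v x)‖ := by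
    have h2 : ‖cross (v x) (fderiv ℝ v x (v x))‖ ^ 2 = (|M| * ‖fderiv ℝ v x (v x)‖) ^ 2 := by
      rw [hlag, mul_pow, sq_abs]; ring
    exact (pow_left_inj₀ (norm_nonneg _) (by positivity) two_ne_zero).1 h2
  rw [curl_perp_eq_cross_fderiv_self hv hM hM0 x, norm_smul, norm_inv, norm_pow, Real.norm_eq_abs, hn]
  field_simp

/-- **Stretching is controlled by the bend: `|⟪ω, Dv ω⟫| ≤ ‖Dv‖ · ‖Dv·v‖²/M²`** pointwise for a constant-speed field.
[folklore] -/
theorem abs_curl_stretching_le_bend (hv : Differentiable ℝ v) (hM : ∀ x, ‖v x‖ = M) (hM0 : M ≠ 0) (x : E3) :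
    |⟪curl v x, fderiv ℝ v x (curl v x)⟫_ℝ| ≤ ‖fderiv ℝ v x‖ * (‖fderiv ℝ v x (v x)‖ ^ 2 / M ^ 2) := by
  have h := abs_curl_stretching_le_perp hv hM hM0 x
  rw [← norm_sq_curl_perp hM hM0 x, norm_curl_perp_eq hv hM hM0 x, div_pow, sq_abs] at h
  exact h

end ExtremiserLiouville

end Summit.NavierStokesRegularity.NavierStokesRegularity.Theorems

end
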